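import Literature.NumberTheory.ModularForms.BinaryThetaHigherWeightLines
import Literature.NumberTheory.ModularForms.BinaryThetaNull
import Mathlib.LinearAlgebra.SymplecticGroup
import Mathlib.NumberTheory.ModularForms.SlashActions
import HarnessLib

/-!
# Binary theta series of weight `n + 1` on lines: the inversion `τ ↦ -1/τ`
# (Hecke 1926 §3; Schoeneberg 1939 — theta series with a spherical polynomial, weight `n + 1`)

Topic `Literature/NumberTheory/ModularForms`; namespace `Literature.NumberTheory.ModularForms.BinaryTheta`.
Everything here is PROVED (theorems only; no definition, no named fact).  Sequel of
`BinaryThetaHigherWeightLines`; the order-`n` analogue of the weight-two (gradient) inversion law of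
the Summit-side `…HeckeThetaPartnerAdicAtTwoThetaLinesSlash` of route `ResidualThetaTransportAtTwo`.

For the functions `Θₙ[a; b; P; u](τ) = (d/ds)ⁿ ϑ[a; b](s u, τ·P)|₀` (`P ∈ Sym₂(ℚ)` positive definite,
`a, b ∈ ℂ²`) and a direction `u` ISOTROPIC for `P⁻¹` (`ᵗu P' u = 0`, `P'P = 1`):

  `Θₙ[-b; a; P; u](-1/τ) = Λ · τ^{n+1} · Θₙ[a; b; P'; P'u](τ)`   (`iteratedDeriv_line_inv`)

for a constant `Λ` (a unit times `(det P')^{1/2} e(πi k(J, a, b))`) — the genus-two law for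
`J = (0 -1; 1 0)`, `J·(τP') = -(τP')⁻¹ = (-1/τ)P`, with constant `C(τP', J) = λ (det P')^{1/2} τ`
(`BinaryThetaNull.exists_unit_transform_const_eq_mul`), restricted to the isotropic line, where the
quadratic exponential `e(πi ᵗv (τP')⁻¹ v)` is `1`, and differentiated `n` times (`n` more factors `τ`
from the change of variable `v ↦ ᵗ(τP')⁻¹ v = τ⁻¹ P v`).

* `iteratedDeriv_comp_mulVec_eq_of_law` — `∂ⁿ_s θ₂(s·Aw)|₀ = K ∂ⁿ_s θ₁(s·w)|₀` from
  `θ₂(A v) = K e(πi ᵗvNv) θ₁(v)` and `ᵗwNw = 0`;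
* `iteratedDeriv_line_smul_dir` — homogeneity `∂ⁿ_s θ(s·(c w))|₀ = cⁿ ∂ⁿ_s θ(s·w)|₀`;
* `thetaChar_symplJ` — `J[a; b] = [-b; a]`;
* **`iteratedDeriv_line_inv`** — the inversion law above;
* `riemannThetaChar_add_evenIntSymm` — `ϑ[a; b](z, Ω + S) = e(-πi ᵗaSa) ϑ[a; b + Sa](z, Ω)` for an
  integral symmetric `S` with even diagonal (the generator `(1 S; 0 1)`; used for `τ ↦ τ + 1` in the sequel);
* **`iteratedDeriv_line_slash_S_mem_span`** — with `𝒮ₙ` the set of all `Θₙ[a; b; P; u]` (`a, b ∈ ℚ²`,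
  `u` isotropic for `adj P`): `𝒮ₙ ∣[n+1] S ⊆ span_ℂ 𝒮ₙ`.

## References

* E. Hecke, *Zur Theorie der elliptischen Modulfunktionen*, Math. Ann. 97 (1926), §3. [Hecke1926Modulfunktionen]
* D. Zagier, *Elliptic modular forms and their applications* (The 1-2-3 of Modular Forms, 2008), §3.2. [Zagier2008]
* H. Lange, C. Birkenhake, *Complex Abelian Varieties* (1992), §3.3.3 Thm. 3.3.9 (the theta
  transformation formula with the parameter `v`). [LangeBirkenhake1992]
* D. Mumford, *Tata Lectures on Theta I* (1983), Ch. II §5 (the functional equation; the generator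
  `(1 S; 0 1)`). [MumfordTata1]
-/

noncomputable section

open Matrix Complex Filter Topology Set

open scoped Real MatrixGroups UpperHalfPlane Manifold ModularForm

namespace Literature.NumberTheory.ModularForms.BinaryTheta

open Literature.Analysis.SpecialFunctions
open Literature.NumberTheory.Automorphic (siegelUpperHalfSpace mem_siegelUpperHalfSpace_iff)
open Literature.NumberTheory.ModularForms.SiegelUpperHalfSpace (denom moeb)

/-! ### Comparison lemmas for `n`-th derivatives along lines -/

/-- **`∂ⁿ_s θ₂(s·Aw)|₀ = K · ∂ⁿ_s θ₁(s·w)|₀`** if `θ₂(A v) = K e(πi ᵗvNv) θ₁(v)` for all `v`, `θ₁`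
differentiable on `ℂᵐ`, and `w` is isotropic for `N`: on the line `v = s w` the exponential is `1`
and `A(s w) = s (A w)`, so the two one-variable functions agree identically (the order-`n` analogue of
the Summit-side `HeckeTheta.fderiv_comp_mulVec_eq_of_law`). [cite: Hecke1926Modulfunktionen, §3] -/
theorem iteratedDeriv_comp_mulVec_eq_of_law {m : ℕ} {θ₁ θ₂ : (Fin m → ℂ) → ℂ}
    (h₁ : Differentiable ℂ θ₁) (A : Matrix (Fin m) (Fin m) ℂ) {K : ℂ} (N : Matrix (Fin m) (Fin m) ℂ)
    (hlaw : ∀ v : Fin m → ℂ, θ₂ (A *ᵥ v) = K * cexp (π * I * (v ⬝ᵥ (N *ᵥ v))) * θ₁ v)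
    {w : Fin m → ℂ} (hw : w ⬝ᵥ (N *ᵥ w) = 0) (n : ℕ) :
    iteratedDeriv n (fun s : ℂ => θ₂ (s • (A *ᵥ w))) 0 = K * iteratedDeriv n (fun s : ℂ => θ₁ (s • w)) 0 := by
  have hfun : (fun s : ℂ => θ₂ (s • (A *ᵥ w))) = fun s => K * θ₁ (s • w) := by
    funext s
    have h := hlaw (s • w)
    simp only [Matrix.mulVec_smul, dotProduct_smul, smul_dotProduct] at h
    rw [h, hw, smul_zero, smul_zero, mul_zero, Complex.exp_zero, mul_one]
  have hline : Differentiable ℂ (fun s : ℂ => s • w) := fun s => differentiableAt_id.smul_const w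
  have hfc : ContDiff ℂ n (fun s : ℂ => θ₁ (s • w)) := (h₁.comp hline).contDiff
  rw [hfun, iteratedDeriv_const_mul K hfc.contDiffAt]

/-- **Homogeneity of the `n`-th line derivative in the direction**:
`∂ⁿ_s θ(s·(c w))|₀ = cⁿ · ∂ⁿ_s θ(s·w)|₀` (`θ` differentiable). [folklore] -/
private theorem iteratedDeriv_line_smul_dir {m : ℕ} {θ : (Fin m → ℂ) → ℂ} (hθ : Differentiable ℂ θ)
    (w : Fin m → ℂ) (c : ℂ) (n : ℕ) :
    iteratedDeriv n (fun s : ℂ => θ (s • (c • w))) 0 = c ^ n * iteratedDeriv n (fun s : ℂ => θ (s • w)) 0 := by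
  have hline : Differentiable ℂ (fun s : ℂ => s • w) := fun s => differentiableAt_id.smul_const w
  have hfc : ContDiff ℂ n (fun s : ℂ => θ (s • w)) := (hθ.comp hline).contDiff
  have hfun : (fun s : ℂ => θ (s • (c • w))) = fun s => (fun s : ℂ => θ (s • w)) (c * s) := by
    funext s; simp only [smul_smul, mul_comm s c]
  rw [hfun, iteratedDeriv_comp_const_mul hfc c]
  simp only [mul_zero]

/-! ### The inversion `τ ↦ -1/τ` -/

/-- The characteristic map of `J = (0 -1; 1 0)`: `J[a; b] = [-b; a]` (twin of the Summit-side
`HeckeTheta.thetaChar_J`). [cite: LangeBirkenhake1992, §3.3.3 Lemma 3.3.8] -/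
theorem thetaChar_symplJ (a b : Fin 2 → ℂ) :
    thetaCharFst (Matrix.J (Fin 2) ℤ) a b = -b ∧ thetaCharSnd (Matrix.J (Fin 2) ℤ) a b = a := by
  have hJ : (Matrix.J (Fin 2) ℤ).map ((↑) : ℤ → ℂ) = fromBlocks 0 (-1) 1 0 := by
    rw [Matrix.J, fromBlocks_map]
    simp [Matrix.map_zero Int.cast Int.cast_zero, Matrix.map_one Int.cast Int.cast_zero Int.cast_one,
      Matrix.map_neg]
  constructor
  · rw [thetaCharFst_def, hJ]
    funext i
    fin_cases i <;> simp [Matrix.J, Matrix.toBlocks₂₁, Matrix.toBlocks₂₂, Matrix.mul_apply]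
  · rw [thetaCharSnd_def, hJ]
    funext i
    fin_cases i <;> simp [Matrix.J, Matrix.toBlocks₁₁, Matrix.toBlocks₁₂, Matrix.mul_apply]

/-- **The inversion law for the `n`-th line derivatives of binary theta functions.**  `P, P' ∈ M₂(ℚ)`,
`P'` symmetric positive definite, `P'P = 1` (so `P = P'⁻¹` is symmetric positive definite too); then there is a constant `Λ` (a unit times `(det P')^{1/2} e(πi k(J,a,b))`)
such that for all `τ ∈ ℍ` and every `u ∈ ℂ²` with `ᵗu P' u = 0`:
`∂ⁿ_s ϑ[-b; a](s u, (-1/τ)·P)|₀ = Λ τ^{n+1} ∂ⁿ_s ϑ[a; b](s P'u, τ·P')|₀`.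
(For `n = 1` — where no isotropy is needed — this is the Summit-side `HeckeTheta.fderiv_line_inv`.)
[cite: Hecke1926Modulfunktionen, §3] [cite: LangeBirkenhake1992, §3.3.3 Thm. 3.3.9] -/
theorem iteratedDeriv_line_inv {P P' : Matrix (Fin 2) (Fin 2) ℚ} (hP's : P'.IsSymm)
    (hP'pos : (P'.map (Rat.cast : ℚ → ℝ)).PosDef) (hPP' : P' * P = 1) (a b : Fin 2 → ℂ) (n : ℕ) :
    ∃ Λ : ℂ, ∀ τ : ℍ, ∀ u : Fin 2 → ℂ, u ⬝ᵥ (P'.map (Rat.cast : ℚ → ℂ) *ᵥ u) = 0 →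
      iteratedDeriv n (fun s : ℂ =>
          riemannThetaChar (-b) a ((-((τ : ℂ)⁻¹)) • P.map (Rat.cast : ℚ → ℂ)) (s • u)) 0 =
        Λ * (τ : ℂ) ^ (n + 1) *
          iteratedDeriv n (fun s : ℂ =>
            riemannThetaChar a b ((τ : ℂ) • P'.map (Rat.cast : ℚ → ℂ)) (s • (P'.map (Rat.cast : ℚ → ℂ) *ᵥ u))) 0 := by
  set Q : Matrix (Fin 2) (Fin 2) ℂ := P'.map (Rat.cast : ℚ → ℂ) with hQdef
  set Pc : Matrix (Fin 2) (Fin 2) ℂ := P.map (Rat.cast : ℚ → ℂ) with hPcdef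
  have hQP : Q * Pc = 1 := by
    have h := congrArg (fun M : Matrix (Fin 2) (Fin 2) ℚ => M.map (Rat.castHom ℂ : ℚ →+* ℂ)) hPP'
    simp only [Matrix.map_mul] at h
    rw [Matrix.map_one _ (map_zero _) (map_one _)] at h
    exact h
  have hM := SymplecticGroup.J_mem (Fin 2) ℤ
  have hP : ∀ τ : ℂ, 0 < τ.im → τ • Q ∈ siegelUpperHalfSpace 2 := fun τ hτ =>
    ratSmul_mem_siegelUpperHalfSpace hP's hP'pos hτ
  -- the square root of `det P'`
  have hdetpos : 0 < (P'.det : ℝ) := by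
    have h := hP'pos.det_pos
    rwa [← Rat.cast_det] at h
  set s : ℝ := Real.sqrt (P'.det : ℝ) with hs
  have hs2 : ((s : ℂ)) ^ 2 = ((P'.det : ℚ) : ℂ) := by
    rw [← Complex.ofReal_pow, hs, Real.sq_sqrt hdetpos.le, Complex.ofReal_ratCast]
  have hs0 : (s : ℂ) ≠ 0 := by
    rw [Complex.ofReal_ne_zero, hs]; exact (Real.sqrt_pos.mpr hdetpos).ne'
  set ℓ : ℂ → ℂ := fun τ => τ * s with hℓ
  have hℓc : ContinuousOn ℓ {τ : ℂ | 0 < τ.im} := (continuous_id.mul continuous_const).continuousOn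
  have hℓ0 : ∀ τ : ℂ, 0 < τ.im → ℓ τ ≠ 0 := fun τ hτ =>
    mul_ne_zero (fun h => by simp [h] at hτ) hs0
  have hdet : ∀ τ : ℂ, 0 < τ.im →
      (denom ((Matrix.J (Fin 2) ℤ).map ((↑) : ℤ → ℂ)) (τ • Q)).det = ℓ τ ^ 2 := by
    intro τ _
    obtain ⟨hden, -, -⟩ := denom_moeb_J (g := 2) (τ • Q)
    rw [hden, Matrix.det_smul, Fintype.card_fin, hQdef, ← Rat.cast_det, hℓ]
    simp only
    rw [mul_pow, hs2]
  obtain ⟨Λ₀, -, hpin⟩ := exists_unit_transform_const_eq_mul hM hP hℓc hℓ0 hdet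
  obtain ⟨hFst, hSnd⟩ := thetaChar_symplJ a b
  refine ⟨Λ₀ * s * cexp (π * I * thetaTransformPhase (Matrix.J (Fin 2) ℤ) a b), fun τ u hu => ?_⟩
  have hτ0 : (τ : ℂ) ≠ 0 := UpperHalfPlane.ne_zero τ
  have hZ := hP τ τ.im_pos
  obtain ⟨C, -, hCv⟩ := exists_riemannThetaChar_transform hM hZ a b
  obtain ⟨C₀, -, hC₀⟩ := exists_riemannThetaChar_transform hM hZ 0 0
  have hCC₀ := riemannThetaChar_transform_const_eq hM hZ a b hCv hC₀
  have hC₀' := hpin τ τ.im_pos C₀ hC₀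
  obtain ⟨hden, h21, hmoeb⟩ := denom_moeb_J (g := 2) ((τ : ℂ) • Q)
  -- the inverse of `τ·Q` is `τ⁻¹·P`
  have hinv : ((τ : ℂ) • Q)⁻¹ = (τ : ℂ)⁻¹ • Pc := by
    refine Matrix.inv_eq_right_inv ?_
    rw [Matrix.smul_mul, Matrix.mul_smul, hQP, smul_smul, mul_inv_cancel₀ hτ0, one_smul]
  have hsymQ : ((τ : ℂ) • Q).IsSymm := (hP's.map _).smul _
  have htinv : ((τ : ℂ) • Q)ᵀ⁻¹ = (τ : ℂ)⁻¹ • Pc := by rw [hsymQ.eq, hinv]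
  -- the law in `v`
  have hlaw : ∀ v : Fin 2 → ℂ,
      riemannThetaChar (-b) a ((-((τ : ℂ)⁻¹)) • Pc) (((τ : ℂ)⁻¹ • Pc) *ᵥ v) =
        C * cexp (π * I * (v ⬝ᵥ ((((τ : ℂ)⁻¹ • Pc) * 1) *ᵥ v))) *
          riemannThetaChar a b ((τ : ℂ) • Q) v := by
    intro v
    have h := hCv v
    rw [hFst, hSnd, hmoeb, hden, h21, htinv, hinv, ← neg_smul] at h
    exact h
  -- differentiability of `θ₁ = ϑ[a; b](·, τ·Q)`
  have hd₁ : Differentiable ℂ (riemannThetaChar a b ((τ : ℂ) • Q)) := by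
    obtain ⟨hsym, c, hc, hY⟩ := ratLine_hyps hP's hP'pos τ.im_pos
    exact differentiable_riemannThetaChar _ hsym hc hY a b
  -- the direction `w = τ Q u` is isotropic for `N = τ⁻¹ P` and `(τ⁻¹ P)(τ Q u) = u`
  have hdetZ : IsUnit ((τ : ℂ) • Q).det := by
    rw [Matrix.det_smul, Fintype.card_fin, hQdef, ← Rat.cast_det]
    exact (mul_ne_zero (pow_ne_zero _ hτ0) (by exact_mod_cast hdetpos.ne')).isUnit
  have hid : ((τ : ℂ)⁻¹ • Pc) *ᵥ (((τ : ℂ) • Q) *ᵥ u) = u := by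
    rw [Matrix.mulVec_mulVec, ← hinv, Matrix.nonsing_inv_mul _ hdetZ, Matrix.one_mulVec]
  have hw : (((τ : ℂ) • Q) *ᵥ u) ⬝ᵥ (((((τ : ℂ)⁻¹ • Pc) * 1)) *ᵥ (((τ : ℂ) • Q) *ᵥ u)) = 0 := by
    rw [Matrix.mul_one, hid, Matrix.smul_mulVec, smul_dotProduct, smul_eq_mul, dotProduct_comm, hu,
      mul_zero]
  have key := iteratedDeriv_comp_mulVec_eq_of_law hd₁ ((τ : ℂ)⁻¹ • Pc) _ hlaw hw n
  rw [hid] at key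
  -- homogeneity: `∂ⁿ along τ Q u = τⁿ ∂ⁿ along Q u`
  have hhom : iteratedDeriv n (fun s' : ℂ => riemannThetaChar a b ((τ : ℂ) • Q) (s' • (((τ : ℂ) • Q) *ᵥ u))) 0 =
      (τ : ℂ) ^ n * iteratedDeriv n (fun s' : ℂ => riemannThetaChar a b ((τ : ℂ) • Q) (s' • (Q *ᵥ u))) 0 := by
    rw [Matrix.smul_mulVec]
    exact iteratedDeriv_line_smul_dir hd₁ (Q *ᵥ u) (τ : ℂ) n
  rw [key, hhom, hCC₀, hC₀', hℓ]
  simp only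
  ring

/-! ### Integral symmetric shifts of the period matrix (the generator `(1 S; 0 1)`) -/

/-- Termwise version of `riemannThetaChar_add_evenIntSymm` (twin of the Summit-side
`HeckeTheta.riemannThetaCharTerm_add_intSymm`). [cite: MumfordTata1, Ch. II §5] -/
theorem riemannThetaCharTerm_add_evenIntSymm {S : Matrix (Fin 2) (Fin 2) ℤ} (hS : S.IsSymm)
    (h00 : Even (S 0 0)) (h11 : Even (S 1 1)) (a b : Fin 2 → ℂ) (Ω : Matrix (Fin 2) (Fin 2) ℂ)
    (z : Fin 2 → ℂ) (m : Fin 2 → ℤ) :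
    riemannThetaCharTerm a b (Ω + S.map ((↑) : ℤ → ℂ)) z m =
      cexp (-(π * I * (a ⬝ᵥ (S.map ((↑) : ℤ → ℂ) *ᵥ a)))) *
        riemannThetaCharTerm a (b + S.map ((↑) : ℤ → ℂ) *ᵥ a) Ω z m := by
  obtain ⟨e0, he0⟩ := h00
  obtain ⟨e1, he1⟩ := h11
  have h10 : S 1 0 = S 0 1 := hS.apply 0 1
  rw [riemannThetaCharTerm, riemannThetaCharTerm, ← Complex.exp_add]
  -- the exponents differ by `2πi k`, `k = ½ ᵗmSm ∈ ℤ`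
  set k : ℤ := e0 * m 0 ^ 2 + S 0 1 * m 0 * m 1 + e1 * m 1 ^ 2 with hk
  rw [show π * I * (((fun i => (m i : ℂ)) + a) ⬝ᵥ ((Ω + S.map ((↑) : ℤ → ℂ)) *ᵥ ((fun i => (m i : ℂ)) + a))) +
      2 * π * I * (((fun i => (m i : ℂ)) + a) ⬝ᵥ (z + b)) =
      -(π * I * (a ⬝ᵥ (S.map ((↑) : ℤ → ℂ) *ᵥ a))) +
        (π * I * (((fun i => (m i : ℂ)) + a) ⬝ᵥ (Ω *ᵥ ((fun i => (m i : ℂ)) + a))) +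
          2 * π * I * (((fun i => (m i : ℂ)) + a) ⬝ᵥ (z + (b + S.map ((↑) : ℤ → ℂ) *ᵥ a)))) +
        (k : ℂ) * (2 * π * I) by
    simp only [dotProduct, Matrix.mulVec, Fin.sum_univ_two, Matrix.add_apply, Matrix.map_apply,
      Pi.add_apply, h10, hk]
    push_cast
    rw [he0, he1]
    push_cast
    ring, Complex.exp_add, Complex.exp_int_mul_two_pi_mul_I, mul_one]

/-- **`ϑ[a; b](z, Ω + S) = e(-πi ᵗaSa) · ϑ[a; b + Sa](z, Ω)`** for an integral symmetric `S` with even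
diagonal — the theta transformation law for the generator `(1 S; 0 1)` of the theta group, elementary
(termwise `ᵗmSm ∈ 2ℤ`); twin of the Summit-side `HeckeTheta.riemannThetaChar_add_intSymm`.
[cite: MumfordTata1, Ch. II §5] -/
theorem riemannThetaChar_add_evenIntSymm {S : Matrix (Fin 2) (Fin 2) ℤ} (hS : S.IsSymm)
    (h00 : Even (S 0 0)) (h11 : Even (S 1 1)) (a b : Fin 2 → ℂ) (Ω : Matrix (Fin 2) (Fin 2) ℂ)
    (z : Fin 2 → ℂ) :
    riemannThetaChar a b (Ω + S.map ((↑) : ℤ → ℂ)) z =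
      cexp (-(π * I * (a ⬝ᵥ (S.map ((↑) : ℤ → ℂ) *ᵥ a)))) *
        riemannThetaChar a (b + S.map ((↑) : ℤ → ℂ) *ᵥ a) Ω z := by
  unfold riemannThetaChar
  rw [← tsum_mul_left]
  exact tsum_congr fun m => riemannThetaCharTerm_add_evenIntSymm hS h00 h11 a b Ω z m

/-! ### The generating set `𝒮ₙ` is mapped into its span by `∣[n+1] S` -/

/-- **`𝒮ₙ ∣[n+1] S ⊆ span 𝒮ₙ`.**  Here `𝒮ₙ` is the set of the functions
`τ ↦ Θₙ[a; b; P; u](τ) = ∂ⁿ_s ϑ[a; b](s u, τ·P)|₀` on `ℍ` with `P ∈ Sym₂(ℚ)` positive definite,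
`a, b ∈ ℚ²` and `u ∈ ℂ²` isotropic for `adj P` (`ᵗu (adj P) u = 0`); then
`Θₙ[a; b; P; u] ∣_{n+1} S = Λ · Θₙ[b; -a; P⁻¹; P⁻¹u]` with `P⁻¹u` isotropic for `adj P⁻¹`
(order-`n` analogue of the Summit-side weight-two `HeckeTheta.slash_S_mem_span`).
[cite: Hecke1926Modulfunktionen, §3] -/
theorem iteratedDeriv_line_slash_S_mem_span {P : Matrix (Fin 2) (Fin 2) ℚ} (hPs : P.IsSymm)
    (hPpos : (P.map (Rat.cast : ℚ → ℝ)).PosDef) (a b : Fin 2 → ℚ) {u : Fin 2 → ℂ}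
    (hu : u ⬝ᵥ ((P.map (Rat.cast : ℚ → ℂ)).adjugate *ᵥ u) = 0) (n : ℕ) :
    ((fun τ : ℍ => iteratedDeriv n (fun s : ℂ => riemannThetaChar (fun i => (a i : ℂ))
        (fun i => (b i : ℂ)) ((τ : ℂ) • P.map (Rat.cast : ℚ → ℂ)) (s • u)) 0)
        ∣[((n + 1 : ℕ) : ℤ)] ModularGroup.S) ∈
      Submodule.span ℂ {F : ℍ → ℂ | ∃ (P : Matrix (Fin 2) (Fin 2) ℚ), P.IsSymm ∧
        (P.map (Rat.cast : ℚ → ℝ)).PosDef ∧ ∃ (a b : Fin 2 → ℚ) (u : Fin 2 → ℂ),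
          u ⬝ᵥ ((P.map (Rat.cast : ℚ → ℂ)).adjugate *ᵥ u) = 0 ∧ F = fun τ : ℍ =>
            iteratedDeriv n (fun s : ℂ => riemannThetaChar (fun i => (a i : ℂ)) (fun i => (b i : ℂ))
              ((τ : ℂ) • P.map (Rat.cast : ℚ → ℂ)) (s • u)) 0} := by
  -- the inverse matrix
  have hdet : P.det ≠ 0 := by
    have h := hPpos.det_pos
    rw [← Rat.cast_det] at h
    exact_mod_cast h.ne'
  have hinvmul : P⁻¹ * P = 1 := Matrix.nonsing_inv_mul _ (isUnit_iff_ne_zero.mpr hdet)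
  have hmapinv : (P⁻¹).map (Rat.cast : ℚ → ℝ) = (P.map (Rat.cast : ℚ → ℝ))⁻¹ := by
    symm
    refine Matrix.inv_eq_left_inv ?_
    have h := congrArg (fun M : Matrix (Fin 2) (Fin 2) ℚ => M.map (Rat.castHom ℝ : ℚ →+* ℝ)) hinvmul
    simp only [Matrix.map_mul] at h
    rw [Matrix.map_one _ (map_zero _) (map_one _)] at h
    exact h
  have hmapinvC : (P⁻¹).map (Rat.cast : ℚ → ℂ) = (P.map (Rat.cast : ℚ → ℂ))⁻¹ := by
    symm
    refine Matrix.inv_eq_left_inv ?_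
    have h := congrArg (fun M : Matrix (Fin 2) (Fin 2) ℚ => M.map (Rat.castHom ℂ : ℚ →+* ℂ)) hinvmul
    simp only [Matrix.map_mul] at h
    rw [Matrix.map_one _ (map_zero _) (map_one _)] at h
    exact h
  have hP's : (P⁻¹).IsSymm := hPs.inv
  have hP'pos : ((P⁻¹).map (Rat.cast : ℚ → ℝ)).PosDef := by rw [hmapinv]; exact hPpos.inv
  -- `u` is isotropic for `P⁻¹`, and `P⁻¹u` for `adj P⁻¹`
  have huQ : u ⬝ᵥ ((P⁻¹).map (Rat.cast : ℚ → ℂ) *ᵥ u) = 0 := by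
    rw [hmapinvC, Matrix.inv_def, Matrix.smul_mulVec, dotProduct_smul, hu, smul_zero]
  have hu' : ((P⁻¹).map (Rat.cast : ℚ → ℂ) *ᵥ u) ⬝ᵥ
      (((P⁻¹).map (Rat.cast : ℚ → ℂ)).adjugate *ᵥ ((P⁻¹).map (Rat.cast : ℚ → ℂ) *ᵥ u)) = 0 := by
    rw [Matrix.mulVec_mulVec, Matrix.adjugate_mul, Matrix.smul_mulVec, Matrix.one_mulVec,
      dotProduct_smul, dotProduct_comm, huQ, smul_zero]
  obtain ⟨Λ, hΛ⟩ := iteratedDeriv_line_inv hP's hP'pos hinvmul (fun i => (b i : ℂ))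
    (-(fun i => (a i : ℂ))) n
  -- the target generator
  have hmem : (fun τ : ℍ => iteratedDeriv n (fun s : ℂ => riemannThetaChar (fun i => ((b i : ℚ) : ℂ))
      (fun i => ((-a i : ℚ) : ℂ)) ((τ : ℂ) • (P⁻¹).map (Rat.cast : ℚ → ℂ))
      (s • ((P⁻¹).map (Rat.cast : ℚ → ℂ) *ᵥ u))) 0) ∈
      Submodule.span ℂ {F : ℍ → ℂ | ∃ (P : Matrix (Fin 2) (Fin 2) ℚ), P.IsSymm ∧
        (P.map (Rat.cast : ℚ → ℝ)).PosDef ∧ ∃ (a b : Fin 2 → ℚ) (u : Fin 2 → ℂ),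
          u ⬝ᵥ ((P.map (Rat.cast : ℚ → ℂ)).adjugate *ᵥ u) = 0 ∧ F = fun τ : ℍ =>
            iteratedDeriv n (fun s : ℂ => riemannThetaChar (fun i => (a i : ℂ)) (fun i => (b i : ℂ))
              ((τ : ℂ) • P.map (Rat.cast : ℚ → ℂ)) (s • u)) 0} :=
    Submodule.subset_span ⟨P⁻¹, hP's, hP'pos, b, fun i => -a i, _, hu', rfl⟩
  have heq : ((fun τ : ℍ => iteratedDeriv n (fun s : ℂ => riemannThetaChar (fun i => (a i : ℂ))
        (fun i => (b i : ℂ)) ((τ : ℂ) • P.map (Rat.cast : ℚ → ℂ)) (s • u)) 0)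
        ∣[((n + 1 : ℕ) : ℤ)] ModularGroup.S) =
      Λ • fun τ : ℍ => iteratedDeriv n (fun s : ℂ => riemannThetaChar (fun i => ((b i : ℚ) : ℂ))
        (fun i => ((-a i : ℚ) : ℂ)) ((τ : ℂ) • (P⁻¹).map (Rat.cast : ℚ → ℂ))
        (s • ((P⁻¹).map (Rat.cast : ℚ → ℂ) *ᵥ u))) 0 := by
    funext τ
    rw [ModularForm.SL_slash_apply, ModularGroup.denom_S, Pi.smul_apply, smul_eq_mul]
    have hτ0 : (τ : ℂ) ≠ 0 := UpperHalfPlane.ne_zero τ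
    have hcoe : ((ModularGroup.S • τ : ℍ) : ℂ) = -((τ : ℂ)⁻¹) := by
      rw [UpperHalfPlane.modular_S_smul]; simp [inv_neg]
    simp only [hcoe]
    have hneg : (fun i => ((-a i : ℚ) : ℂ)) = -(fun i => (a i : ℂ)) := by
      funext i; push_cast; rfl
    have h := hΛ τ u huQ
    rw [neg_neg] at h
    rw [h, hneg, _root_.zpow_neg, zpow_natCast]
    field_simp
  rw [heq]
  exact Submodule.smul_mem _ _ hmem

end Literature.NumberTheory.ModularForms.BinaryTheta

end
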